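import Summits.CriticalPhenomena.Ising3DConformalLimit.Theses.BallOrbitComparison
import Literature.Probability.LatticeModels.CriticalScalingDimension
import Literature.Probability.LatticeModels.MessagerMiracleSole

/-!
# Crux `BallOrbitComparison.TwoPointRegularVariation` (stmt-CriticalPhenomena-5047) — birth skeleton `Lines/birth.lean`

Skeleton-registrar seat `planner-skel-stmt-CriticalPhenomena-5047-0`, 2026-08-17 (route re-audit bin
REPAIRABLE; BC3 of `run/shared/lean/lens3/_common/BC.md`). Route
`route-CriticalPhenomena-BallOrbitComparison`, sub-problem `Ising3DConformalLimit`. Line card: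
`Lines/birth.md`.

The crux (RV): with `ρ_c(δ) := ⟨σ₀σ_{⌊1/δ⌋e₀}⟩_{β_c(3)}^{-1/2}` there is `Δ > 0` such that
`ρ_c(cδ)/ρ_c(δ) → c^{-Δ}` as `δ → 0⁺` for every `c > 0` — Karamata regular variation of the
critical two-point function along the axis (existence of `η` in power-law form, `2Δ = 1 + η`).

Write `G := criticalTwoPoint 3` and let `f(x) := G(⌊x⌋ e₀)` be the AXIS STEP PROFILE (a function of
a real variable; `ρ_c(δ) = f(δ⁻¹)^{-1/2}` literally). The crux says exactly: `f` is regularly varying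
at `+∞` with NEGATIVE index `-2Δ`. It is cut along three mathematically distinct contents — the two
classical halves of Karamata theory for MONOTONE functions and the lattice input that pins the sign
of the index — none of which is the crux reworded (BC3 probes in the card):

* S1 `DecimationRatios` / `stub_decimationRatios` (Ising-specific, OPEN, load-bearing) — the dyadic
  and triadic decimation ratios of the profile converge to positive limits:
  `f(2x)/f(x) → a > 0` and `f(3x)/f(x) → b > 0` as `x → ∞`. Two multiplicatively independent scales
  and nothing else: no limit is asserted for other `c`, no power form, no sign. This is where the
  log-periodic obstruction lives (a wobble `n^{-2Δ}(1 + ε cos(ω log n))` with `ω log 2 ∈ 2πℤ` passes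
  the dyadic test and fails the triadic one). [open; arXiv:1912.07973 §5 (regular scales),
  arXiv:2404.05700 Thm 1.5, DuminilCopinICM2022 §8.4; tree: the dyadic instance GIVEN a scale-covariant
  limit is `tendsto_rho_sq_ratio`]
* S2 `MonotoneKaramata` / `stub_monotoneKaramata` (pure analysis, classical, M/L-sized in Lean; no
  Karamata theory in Mathlib) — Feller's theorem for monotone functions (Feller1971 §VIII.8 Lemma 1
  eqs. (8.3)–(8.4) and Theorem, pp. 275–276; BinghamGoldieTeugels1987 §1.10): a positive function,
  antitone on `[1, ∞)`, whose ratio limits exist and are positive at the two scales `2` and `3`, is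
  regularly varying: `∃ κ, ∀ c > 0, f(cx)/f(x) → c^κ`. (The limits propagate to the group `2^ℤ3^ℤ`,
  dense in `(0,∞)` because `log 3 / log 2 ∉ ℚ`; monotonicity forces ONE exponent and squeezes the
  other scales.) Monotonicity of OUR `f` is the Messager–Miracle-Solé inequality, a tree theorem
  (`messager_miracleSole_holds`), discharged in the composition below, not assumed.
* S3 `IndexWindow` / `stub_indexWindow` (lattice input ⇒ sign and size of the index; provable now,
  M-sized) — if the dyadic ratio of the profile tends to `2^κ` then `κ ∈ [-2, -1]`: telescoping over
  the scales `2^k`, Cesàro, and the two-point bounds `c‖x‖⁻² ≤ G ≤ C‖x‖⁻¹`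
  (`criticalTwoPoint_bounds_holds`; the argument of `scalingDimension_mem_Icc_of_bounds`, there under
  scaling-limit hypotheses). Gives `Δ = -κ/2 ∈ [1/2, 1]`, in particular `Δ > 0`, which the crux
  demands and S1–S2 alone cannot give (a constant profile satisfies S1–S2 with `κ = 0`).

Composition `TwoPointRegularVariation_of : S1 → S2 → S3 → TwoPointRegularVariation` is kernel-checked
below with NO sorry (hypotheses = the registered stubs BY NAME via the implementation-detail aliases
`__Registered.stub_…`, device of `Cruxes/InverseSquareLaw/Lines/birth.lean`): positivity of the profile
on `[1,∞)` (Simon–Lieb lower bound, `criticalTwoPoint_bounds_holds`) and its antitonicity (MMS,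
`messager_miracleSole_holds`) are PROVED here and fed to S2 together with S1; S3 at the dyadic limit
`2^κ` pins `κ ≤ -1`; `Δ := -κ/2 > 0`; and the real-variable statement of the crux is the S2-limit at
`c⁻¹` read along `δ ↦ δ⁻¹ → +∞` (`tendsto_inv_nhdsGT_zero`), raised to the power `-1/2`
(`Filter.Tendsto.rpow_const`), with the pointwise identity
`(f(c⁻¹δ⁻¹)/f(δ⁻¹))^{-1/2} = ρ_c(cδ)/ρ_c(δ)` valid once `δ ≤ min(1, c⁻¹)`.
`TwoPointRegularVariation_of_stubs` applies it to the three `stub_…` literally (statements = aliases =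
stubs; NOT closed: `sorryAx` via the stubs, as the audit must report).

Disproof used: none — `Cruxes/TwoPointRegularVariation/` had no `Disproof.lean` and the item no evidence
at registration time (`ledger crux ls stmt-CriticalPhenomena-5047`: no workfiles); `ledger negatives
--problem CriticalPhenomena` (11 entries) touches no two-point / regular-variation statement.
-/

namespace Summit.CriticalPhenomena.Ising3DConformalLimit.Cruxes.TwoPointRegularVariation.Birth

open Filter Topology Literature.Probability.LatticeModels
open Summit.CriticalPhenomena.Ising3DConformalLimit.Theses.BallOrbitComparison

/-! ## The three statements, named (plain `def`s — no gate-reserved attributes in a workfile) -/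

/-- **S1 (decimation ratios at the scales 2 and 3).** The axis step profile
`f(x) = ⟨σ₀σ_{⌊x⌋e₀}⟩_{β_c(3)}` has positive ratio limits `f(2x)/f(x) → a` and `f(3x)/f(x) → b`
as `x → +∞`. -/
def DecimationRatios : Prop :=
  (∃ a : ℝ, 0 < a ∧ Filter.Tendsto (fun x : ℝ => Literature.Probability.LatticeModels.criticalTwoPoint 3 (Pi.single 0 ⌊2 * x⌋) / Literature.Probability.LatticeModels.criticalTwoPoint 3 (Pi.single 0 ⌊x⌋)) Filter.atTop (nhds a)) ∧
  (∃ b : ℝ, 0 < b ∧ Filter.Tendsto (fun x : ℝ => Literature.Probability.LatticeModels.criticalTwoPoint 3 (Pi.single 0 ⌊3 * x⌋) / Literature.Probability.LatticeModels.criticalTwoPoint 3 (Pi.single 0 ⌊x⌋)) Filter.atTop (nhds b))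

/-- **S2 (Feller–Karamata for monotone functions, two incommensurable scales).** A function positive
and antitone on `[1, ∞)` whose ratio limits at the scales `2` and `3` exist and are positive is
regularly varying at `+∞`: all ratio limits exist and are powers `c^κ` of one exponent. -/
def MonotoneKaramata : Prop :=
  ∀ f : ℝ → ℝ, (∀ x : ℝ, 1 ≤ x → 0 < f x) → AntitoneOn f (Set.Ici 1) →
    (∃ a : ℝ, 0 < a ∧ Filter.Tendsto (fun x : ℝ => f (2 * x) / f x) Filter.atTop (nhds a)) →
    (∃ b : ℝ, 0 < b ∧ Filter.Tendsto (fun x : ℝ => f (3 * x) / f x) Filter.atTop (nhds b)) →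
    ∃ κ : ℝ, ∀ c : ℝ, 0 < c → Filter.Tendsto (fun x : ℝ => f (c * x) / f x) Filter.atTop (nhds (c ^ κ))

/-- **S3 (index window from the two-point bounds).** If the dyadic ratio of the axis step profile
tends to `2^κ`, then `-2 ≤ κ ≤ -1` (`c‖x‖⁻² ≤ ⟨σ₀σ_x⟩ ≤ C‖x‖⁻¹` on `ℤ³`). -/
def IndexWindow : Prop :=
  ∀ κ : ℝ, Filter.Tendsto (fun x : ℝ => Literature.Probability.LatticeModels.criticalTwoPoint 3 (Pi.single 0 ⌊2 * x⌋) / Literature.Probability.LatticeModels.criticalTwoPoint 3 (Pi.single 0 ⌊x⌋)) Filter.atTop (nhds ((2 : ℝ) ^ κ)) → κ ∈ Set.Icc (-2 : ℝ) (-1)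

/-! ## The registered stubs (the only `sorry`s of the file), statements verbatim -/

/-- **S1** — statement `DecimationRatios` verbatim: positive limits of the dyadic and triadic
decimation ratios of `x ↦ ⟨σ₀σ_{⌊x⌋e₀}⟩_{β_c(3)}`. Hardest stub (open: the log-periodic obstruction). -/
theorem stub_decimationRatios :
    (∃ a : ℝ, 0 < a ∧ Filter.Tendsto (fun x : ℝ => Literature.Probability.LatticeModels.criticalTwoPoint 3 (Pi.single 0 ⌊2 * x⌋) / Literature.Probability.LatticeModels.criticalTwoPoint 3 (Pi.single 0 ⌊x⌋)) Filter.atTop (nhds a)) ∧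
    (∃ b : ℝ, 0 < b ∧ Filter.Tendsto (fun x : ℝ => Literature.Probability.LatticeModels.criticalTwoPoint 3 (Pi.single 0 ⌊3 * x⌋) / Literature.Probability.LatticeModels.criticalTwoPoint 3 (Pi.single 0 ⌊x⌋)) Filter.atTop (nhds b)) := by
  sorry

/-- **S2** — statement `MonotoneKaramata` verbatim (Feller1971 §VIII.8, Lemma 1 and Theorem;
BinghamGoldieTeugels1987 §1.10): monotone + positive ratio limits at `2` and `3` ⇒ regular variation. -/
theorem stub_monotoneKaramata :
    ∀ f : ℝ → ℝ, (∀ x : ℝ, 1 ≤ x → 0 < f x) → AntitoneOn f (Set.Ici 1) →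
      (∃ a : ℝ, 0 < a ∧ Filter.Tendsto (fun x : ℝ => f (2 * x) / f x) Filter.atTop (nhds a)) →
      (∃ b : ℝ, 0 < b ∧ Filter.Tendsto (fun x : ℝ => f (3 * x) / f x) Filter.atTop (nhds b)) →
      ∃ κ : ℝ, ∀ c : ℝ, 0 < c → Filter.Tendsto (fun x : ℝ => f (c * x) / f x) Filter.atTop (nhds (c ^ κ)) := by
  sorry

/-- **S3** — statement `IndexWindow` verbatim: a dyadic ratio limit `2^κ` of the axis step profile
has `κ ∈ [-2, -1]` (telescoping + Cesàro + `criticalTwoPoint_bounds_holds`). Provable now (M). -/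
theorem stub_indexWindow :
    ∀ κ : ℝ, Filter.Tendsto (fun x : ℝ => Literature.Probability.LatticeModels.criticalTwoPoint 3 (Pi.single 0 ⌊2 * x⌋) / Literature.Probability.LatticeModels.criticalTwoPoint 3 (Pi.single 0 ⌊x⌋)) Filter.atTop (nhds ((2 : ℝ) ^ κ)) → κ ∈ Set.Icc (-2 : ℝ) (-1) := by
  sorry

/-! ## Aliases keyed by the registered stub names

`__Registered.stub_X` is the statement of `stub_X` under the stub's short name, so that the native
skeleton audit (`#h21_check_skeleton`: hypotheses admissible iff registered obligations / declared
stubs BY NAME) accepts `TwoPointRegularVariation_of : __Registered.stub_… → … → TwoPointRegularVariation`. -/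
namespace __Registered

/-- Alias of `DecimationRatios` keyed by the registered stub name. -/
abbrev stub_decimationRatios : Prop := DecimationRatios
/-- Alias of `MonotoneKaramata` keyed by the registered stub name. -/
abbrev stub_monotoneKaramata : Prop := MonotoneKaramata
/-- Alias of `IndexWindow` keyed by the registered stub name. -/
abbrev stub_indexWindow : Prop := IndexWindow

end __Registered

/-! ## Glue proved here (no sorry): the axis step profile is positive and antitone on `[1, ∞)` -/

/-- `0 < ⟨σ₀σ_{⌊x⌋e₀}⟩_{β_c(3)}` for `x ≥ 1` (Simon–Lieb lower bound `c‖x‖⁻² ≤ G`, tree theorem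
`criticalTwoPoint_bounds_holds`). [folklore] -/
theorem axisProfile_pos (x : ℝ) (hx : 1 ≤ x) :
    0 < criticalTwoPoint 3 (Pi.single 0 ⌊x⌋) := by
  obtain ⟨c, C, hc, hbd⟩ := criticalTwoPoint_bounds_holds (d := 3) le_rfl
  have hfl : 0 < ⌊x⌋ := Int.floor_pos.2 hx
  have hne : (Pi.single (0 : Fin 3) ⌊x⌋ : Site 3) ≠ 0 := by
    intro h
    have h0 := congrFun h 0
    simp only [Pi.single_eq_same, Pi.zero_apply] at h0
    exact hfl.ne' h0
  have h1 := (hbd _ hne).1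
  refine lt_of_lt_of_le ?_ h1
  exact mul_pos hc (Real.rpow_pos_of_pos (norm_pos_iff.2 hne) _)

/-- `⟨σ₀σ_{(n+1)e₀}⟩ ≤ ⟨σ₀σ_{ne₀}⟩` at `β_c(3)` for `0 ≤ n` (Messager–Miracle-Solé, tree theorem
`messager_miracleSole_holds`). [folklore] -/
theorem axisProfile_succ_le (n : ℤ) (hn : 0 ≤ n) :
    criticalTwoPoint 3 (Pi.single 0 (n + 1)) ≤ criticalTwoPoint 3 (Pi.single 0 n) := by
  have h := messager_miracleSole_holds (d := 3) (β := criticalBeta 3) (criticalBeta_nonneg 3)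
    (Pi.single (0 : Fin 3) n) 0 (by rw [Pi.single_eq_same]; exact hn)
  rw [← Pi.single_add] at h
  exact h

/-- Iterated MMS step: `⟨σ₀σ_{(n+k)e₀}⟩ ≤ ⟨σ₀σ_{ne₀}⟩` for `0 ≤ n`, `k ∈ ℕ`. [folklore] -/
theorem axisProfile_add_le (n : ℤ) (hn : 0 ≤ n) (k : ℕ) :
    criticalTwoPoint 3 (Pi.single 0 (n + k)) ≤ criticalTwoPoint 3 (Pi.single 0 n) := by
  induction k with
  | zero => simp
  | succ k ih =>
    have h1 := axisProfile_succ_le (n + k) (by omega)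
    have h2 : (n + ((k + 1 : ℕ) : ℤ) : ℤ) = n + k + 1 := by push_cast; ring
    rw [h2]
    exact h1.trans ih

/-- The axis step profile `x ↦ ⟨σ₀σ_{⌊x⌋e₀}⟩_{β_c(3)}` is antitone on `[1, ∞)` (MMS + monotonicity
of `⌊·⌋`). [folklore] -/
theorem axisProfile_antitoneOn :
    AntitoneOn (fun x : ℝ => criticalTwoPoint 3 (Pi.single 0 ⌊x⌋)) (Set.Ici 1) := by
  intro x hx y _hy hxy
  have hx1 : (1 : ℝ) ≤ x := hx
  have hx0 : (0 : ℤ) ≤ ⌊x⌋ := Int.floor_nonneg.2 (zero_le_one.trans hx1)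
  have hfl : ⌊x⌋ ≤ ⌊y⌋ := Int.floor_le_floor hxy
  obtain ⟨k, hk⟩ : ∃ k : ℕ, ⌊y⌋ = ⌊x⌋ + k :=
    ⟨(⌊y⌋ - ⌊x⌋).toNat, by rw [Int.toNat_of_nonneg (sub_nonneg.2 hfl)]; ring⟩
  show criticalTwoPoint 3 (Pi.single 0 ⌊y⌋) ≤ criticalTwoPoint 3 (Pi.single 0 ⌊x⌋)
  rw [hk]
  exact axisProfile_add_le ⌊x⌋ hx0 k

/-- Pointwise algebra of the renormalisation ratio: for `0 < A`, `0 < B`,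
`(A/B)^{-1/2} = (1/√A)/(1/√B)`. [folklore] -/
theorem ratio_rpow_neg_half {A B : ℝ} (hA : 0 < A) (hB : 0 < B) :
    (A / B) ^ (-(1 / 2 : ℝ)) = 1 / Real.sqrt A / (1 / Real.sqrt B) := by
  rw [Real.rpow_neg (div_pos hA hB).le, ← Real.sqrt_eq_rpow, Real.sqrt_div hA.le, inv_div,
    one_div, one_div, inv_div_inv]

/-! ## Composition: the stubs conclude the crux BY NAME -/

/-- **The skeleton theorem (kernel-checked, sorry-free).** `S1 → S2 → S3 → TwoPointRegularVariation`,
the hypotheses being the registered stubs by name and the conclusion the route decl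
`Theses.BallOrbitComparison.TwoPointRegularVariation`: `κ` from S2 fed with the tree facts
(positivity, MMS antitonicity) and S1; `κ ≤ -1` from S3 at the dyadic limit; `Δ := -κ/2 > 0`; the
crux's limit at `c` is the S2-limit at `c⁻¹` along `δ ↦ δ⁻¹`, raised to the power `-1/2`. -/
theorem TwoPointRegularVariation_of (h1 : __Registered.stub_decimationRatios)
    (h2 : __Registered.stub_monotoneKaramata) (h3 : __Registered.stub_indexWindow) :
    Summit.CriticalPhenomena.Ising3DConformalLimit.Theses.BallOrbitComparison.TwoPointRegularVariation := by
  unfold __Registered.stub_decimationRatios DecimationRatios at h1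
  unfold __Registered.stub_monotoneKaramata MonotoneKaramata at h2
  unfold __Registered.stub_indexWindow IndexWindow at h3
  obtain ⟨ha, hb⟩ := h1
  obtain ⟨κ, hκ⟩ := h2 (fun x : ℝ => criticalTwoPoint 3 (Pi.single 0 ⌊x⌋)) axisProfile_pos
    axisProfile_antitoneOn ha hb
  have hwin : κ ∈ Set.Icc (-2 : ℝ) (-1) := h3 κ (hκ 2 two_pos)
  obtain ⟨_hκlo, hκhi⟩ := Set.mem_Icc.1 hwin
  unfold Summit.CriticalPhenomena.Ising3DConformalLimit.Theses.BallOrbitComparison.TwoPointRegularVariation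
  refine ⟨-κ / 2, by linarith, fun c hc => ?_⟩
  have hc' : (0 : ℝ) < c⁻¹ := inv_pos.2 hc
  -- the Karamata limit at `c⁻¹`, read along `δ ↦ δ⁻¹ → +∞`
  have hT : Tendsto (fun δ : ℝ => criticalTwoPoint 3 (Pi.single 0 ⌊c⁻¹ * δ⁻¹⌋) /
      criticalTwoPoint 3 (Pi.single 0 ⌊δ⁻¹⌋)) (𝓝[>] 0) (𝓝 (c⁻¹ ^ κ)) :=
    (hκ c⁻¹ hc').comp tendsto_inv_nhdsGT_zero
  -- raised to the power `-1/2`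
  have hT2 := hT.rpow_const (p := -(1 / 2 : ℝ)) (Or.inl (Real.rpow_pos_of_pos hc' κ).ne')
  have hval : (c⁻¹ ^ κ) ^ (-(1 / 2 : ℝ)) = c ^ (-(-κ / 2)) := by
    rw [Real.inv_rpow hc.le, ← Real.rpow_neg hc.le, ← Real.rpow_mul hc.le]
    congr 1
    ring
  rw [hval] at hT2
  refine hT2.congr' ?_
  -- eventually `0 < δ < min 1 c⁻¹`, where the profile values are positive and the algebra is exact
  have hev : ∀ᶠ δ in 𝓝[>] (0 : ℝ), δ < min 1 c⁻¹ :=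
    (eventually_lt_nhds (lt_min one_pos hc')).filter_mono nhdsWithin_le_nhds
  filter_upwards [hev, self_mem_nhdsWithin] with δ hδ hδ0
  have hδ0' : (0 : ℝ) < δ := hδ0
  have hδ1 : δ ≤ 1 := (hδ.trans_le (min_le_left _ _)).le
  have hδc : δ ≤ c⁻¹ := (hδ.trans_le (min_le_right _ _)).le
  have hx1 : (1 : ℝ) ≤ δ⁻¹ := (one_le_inv₀ hδ0').2 hδ1
  have hx2 : (1 : ℝ) ≤ c⁻¹ * δ⁻¹ := by
    rw [← mul_inv]
    refine (one_le_inv₀ (mul_pos hc hδ0')).2 ?_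
    calc c * δ ≤ c * c⁻¹ := mul_le_mul_of_nonneg_left hδc hc.le
      _ = 1 := mul_inv_cancel₀ hc.ne'
  show (criticalTwoPoint 3 (Pi.single 0 ⌊c⁻¹ * δ⁻¹⌋) /
      criticalTwoPoint 3 (Pi.single 0 ⌊δ⁻¹⌋)) ^ (-(1 / 2 : ℝ)) =
    1 / Real.sqrt (criticalTwoPoint 3 (Pi.single 0 ⌊(c * δ)⁻¹⌋)) /
      (1 / Real.sqrt (criticalTwoPoint 3 (Pi.single 0 ⌊δ⁻¹⌋)))
  rw [mul_inv]
  exact ratio_rpow_neg_half (axisProfile_pos _ hx2) (axisProfile_pos _ hx1)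

/-- The crux from the registered stubs, applied literally (checks that statements, aliases and stubs
agree; closed modulo exactly `stub_decimationRatios`, `stub_monotoneKaramata`, `stub_indexWindow` —
its axiom closure contains `sorryAx` until every stub is replaced by a landed proof; its type is the
route decl). -/
theorem TwoPointRegularVariation_of_stubs :
    Summit.CriticalPhenomena.Ising3DConformalLimit.Theses.BallOrbitComparison.TwoPointRegularVariation :=
  TwoPointRegularVariation_of stub_decimationRatios stub_monotoneKaramata stub_indexWindow

end Summit.CriticalPhenomena.Ising3DConformalLimit.Cruxes.TwoPointRegularVariation.Birth
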